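import Literature.Computability.Complexity.MatchingSunflowers
import Literature.Combinatorics.SetFamily.RobustSunflower
import HarnessLib

/-!
# Proof of the Matching Sunflower Lemma (Cavalar–Göös–Riazanov–Sofronova–Sokolov, Lemma 2)

Discharges (D-0014) the named fact `CavalarEtAl2026_matchingSunflower` of
`MatchingSunflowers.lean`: there is an absolute constant `c` (here `c = 108 · B²`, `B = 2000`
the constant of the tree's spread lemma) such that every family `𝓕` of `ℓ`-matchings of
`K_{m,m}`, `ℓ ≥ 1`, `0 < ε ≤ 1/2`, with `|𝓕| ≥ (c ℓ log²(ℓ/ε))^ℓ` contains an `ε`-matching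
sunflower (`PerfectMatching.IsMatchingSunflower`, with respect to the odd cut distribution).

The proof is the printed one [cite: CavalarEtAl2026, §2]:

1. *Blocky reduction* (`exists_labelling`): a labelling `b : V(K_{m,m}) → [ℓ]` is CONSISTENT
   with a matching if its edges are monochromatic with distinct labels (`Consistent`); each
   `ℓ`-matching is consistent with `≥ ℓ!·ℓ^{2m−2ℓ}` of the `ℓ^{2m}` labellings
   (`card_consistent_ge`: `ℓ!` edge labellings, free elsewhere), so by averaging some `b` is
   consistent with `≥ |𝓕|·ℓ!/ℓ^{2ℓ}` members.
2. *Vertex sunflower*: consistent matchings are determined by their `2ℓ`-sets of endpoints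
   (`Consistent.eq_of_everts_eq`), and the robust sunflower theorem
   (`Literature.Combinatorics.SetFamily.robust_sunflower_spreadConst`, `p = 1/2`, `ε/2`) gives
   an `ε/2`-robust vertex sunflower with `≥ 2` members once
   `|𝓕| ℓ!/ℓ^{2ℓ} ≥ (2B log(4ℓ/ε))^{2ℓ}`, which follows from `|𝓕| ≥ (108 B² ℓ log²(ℓ/ε))^ℓ`
   by `log(4ℓ/ε) ≤ 3 log(ℓ/ε)` and `ℓ^ℓ ≤ 3^ℓ ℓ!`.
3. *Claim 1* (`good_of_hit`, `card_hit_le_card_good`): with `K` the vertex core, `K₁ ⊆ K` the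
   core vertices alone in their label class (`soloCore`) and `D` the edge core, an edge of a
   member with both endpoints in `K` lies in `D` (`mem_core_of_endpoints`), a core endpoint of
   an edge outside `D` is solo (`eq_endpoint_of_label`), and the involution
   `theta : x ↦ x ⊕ x^{α(x)}` (flip every vertex whose label is that of a solo core vertex
   coloured `0`) maps the event "some member has all non-core endpoints coloured `1`" into the
   event "some member is monochromatic outside `D`"; so the latter has `μ_{1/2}`-probability
   `> 1 − ε/2`.
4. *Parity*: the odd colourings are half of all colourings
   (`PerfectMatching.two_mul_card_oddColorings`), so conditioning on odd parity at most doubles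
   the error: the corresponding matchings form an `ε`-matching sunflower.

Main result: `CavalarEtAl2026_matchingSunflower_holds`.

## References

* B. Cavalar, M. Göös, A. Riazanov, A. Sofronova, D. Sokolov, *Monotone Circuit Complexity of
  Matching*, STOC 2026; arXiv:2507.16105, §2 [CavalarEtAl2026].
* B. P. Cavalar, M. Kumar, B. Rossman, *Monotone circuit lower bounds from robust sunflowers*,
  Algorithmica 84 (2022), Thm. 1.3 [CavalarKumarRossman2022].
-/

namespace Literature.Computability.Complexity

namespace PerfectMatching

open Finset Literature.Combinatorics

variable {m ℓ : ℕ}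

/-! ### Labellings and blocky (consistent) matchings -/

/-- A matching `M` is **consistent** with a labelling `b : Vtx m → Fin ℓ` of the vertices if every
edge is monochromatic under `b` and distinct edges get distinct labels.
[cite: CavalarEtAl2026, §2 ("blocky families")] -/
abbrev Consistent (b : Vtx m → Fin ℓ) (M : Finset (Edge m)) : Prop :=
  (∀ e ∈ M, b (Sum.inl e.1) = b (Sum.inr e.2)) ∧
    ∀ e₁ ∈ M, ∀ e₂ ∈ M, b (Sum.inl e₁.1) = b (Sum.inl e₂.1) → e₁ = e₂

/-- In a consistent matching an edge is determined by the label of its left endpoint, and by the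
label of its right endpoint. [cite: CavalarEtAl2026, §2] -/
theorem Consistent.eq_of_label_eq {b : Vtx m → Fin ℓ} {M : Finset (Edge m)} (h : Consistent b M)
    {e₁ e₂ : Edge m} (h₁ : e₁ ∈ M) (h₂ : e₂ ∈ M)
    (hlab : b (Sum.inl e₁.1) = b (Sum.inr e₂.2)) : e₁ = e₂ :=
  h.2 e₁ h₁ e₂ h₂ (hlab.trans (h.1 e₂ h₂).symm)

/-- **Blocky families are determined by their vertex sets**: two matchings consistent with the
same labelling and with the same set of endpoints are equal. [cite: CavalarEtAl2026, §2 ("𝓕 and 𝒱 are in 1-to-1 correspondence")] -/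
theorem Consistent.eq_of_everts_eq {b : Vtx m → Fin ℓ} {M M' : Finset (Edge m)}
    (hM : Consistent b M) (hM' : Consistent b M') (hV : everts M = everts M') : M = M' := by
  -- one inclusion suffices by symmetry
  suffices key : ∀ {A B : Finset (Edge m)}, Consistent b A → Consistent b B →
      everts A = everts B → A ⊆ B from
    Subset.antisymm (key hM hM' hV) (key hM' hM hV.symm)
  intro A B hA hB hAB e he
  have hu : (Sum.inl e.1 : Vtx m) ∈ everts B := hAB ▸ inl_mem_everts.2 ⟨e, he, rfl⟩
  have hv : (Sum.inr e.2 : Vtx m) ∈ everts B := hAB ▸ inr_mem_everts.2 ⟨e, he, rfl⟩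
  obtain ⟨e', he', h1⟩ := inl_mem_everts.1 hu
  obtain ⟨e'', he'', h2⟩ := inr_mem_everts.1 hv
  -- `e'` and `e''` carry the same label, namely that of `e`
  have hlab : b (Sum.inl e'.1) = b (Sum.inr e''.2) := by
    rw [h1, h2]; exact hA.1 e he
  have hee : e' = e'' := hB.eq_of_label_eq he' he'' hlab
  have : e = e' := by
    subst hee
    exact Prod.ext h1.symm h2.symm
  rw [this]; exact he'


/-! ### Counting: endpoints, and labellings consistent with a fixed matching -/

/-- A matching with `ℓ` edges covers exactly `2ℓ` vertices. [folklore] -/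
private theorem IsMatching.card_everts {M : Finset (Edge m)} (hM : IsMatching M) :
    #(everts M) = 2 * #M := by
  unfold everts
  rw [card_union_of_disjoint, card_image_of_injOn, card_image_of_injOn]
  · ring
  · intro e₁ h₁ e₂ h₂ h
    exact hM.2 e₁ h₁ e₂ h₂ (Sum.inr_injective h)
  · intro e₁ h₁ e₂ h₂ h
    exact hM.1 e₁ h₁ e₂ h₂ (Sum.inl_injective h)
  · rw [disjoint_left]
    intro v hv hv'
    obtain ⟨e, -, rfl⟩ := mem_image.1 hv
    obtain ⟨e', -, h⟩ := mem_image.1 hv'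
    exact Sum.inr_ne_inl h

/-- A matching in `K_{m,m}` has at most `m` edges. [folklore] -/
private theorem IsMatching.card_le {M : Finset (Edge m)} (hM : IsMatching M) : #M ≤ m := by
  rw [← hM.card_image_fst]
  exact (card_le_univ _).trans (by simp)

section Labels

variable {M : Finset (Edge m)} (hM : IsMatching M) (hℓ : 1 ≤ ℓ) (idx : M ≃ Fin ℓ)

/-- the label a permutation `τ` prescribes at a vertex: the (permuted) index of the edge of `M`
covering it, and `0` at uncovered vertices [cite: CavalarEtAl2026, §2 (random labelling `b ∈ [ℓ]^{2n}`)] -/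
noncomputable def labelAt (τ : Equiv.Perm (Fin ℓ)) : Vtx m → Fin ℓ := fun v =>
  match v with
  | Sum.inl u => if h : ∃ e ∈ M, e.1 = u then τ (idx ⟨h.choose, h.choose_spec.1⟩) else ⟨0, hℓ⟩
  | Sum.inr w => if h : ∃ e ∈ M, e.2 = w then τ (idx ⟨h.choose, h.choose_spec.1⟩) else ⟨0, hℓ⟩

include hM in
/-- At the left endpoint of `e ∈ M` the prescribed label is `τ (idx e)`. [folklore] -/
private theorem labelAt_inl (τ : Equiv.Perm (Fin ℓ)) {e : Edge m} (he : e ∈ M) :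
    labelAt hℓ idx τ (Sum.inl e.1) = τ (idx ⟨e, he⟩) := by
  have h : ∃ e' ∈ M, e'.1 = e.1 := ⟨e, he, rfl⟩
  simp only [labelAt, dif_pos h]
  have : h.choose = e := hM.1 _ h.choose_spec.1 _ he h.choose_spec.2
  congr 2
  exact Subtype.ext this

include hM in
/-- At the right endpoint of `e ∈ M` the prescribed label is `τ (idx e)`. [folklore] -/
private theorem labelAt_inr (τ : Equiv.Perm (Fin ℓ)) {e : Edge m} (he : e ∈ M) :
    labelAt hℓ idx τ (Sum.inr e.2) = τ (idx ⟨e, he⟩) := by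
  have h : ∃ e' ∈ M, e'.2 = e.2 := ⟨e, he, rfl⟩
  simp only [labelAt, dif_pos h]
  have : h.choose = e := hM.2 _ h.choose_spec.1 _ he h.choose_spec.2
  congr 2
  exact Subtype.ext this

/-- the labellings that follow the prescription of `τ` on the covered vertices
[cite: CavalarEtAl2026, §2] -/
noncomputable def labBlock (τ : Equiv.Perm (Fin ℓ)) : Finset (Vtx m → Fin ℓ) :=
  univ.filter fun b => ∀ v ∈ everts M, b v = labelAt hℓ idx τ v

include hM in
/-- Labellings following a prescription are consistent with `M`. [cite: CavalarEtAl2026, §2] -/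
theorem consistent_of_mem_labBlock {τ : Equiv.Perm (Fin ℓ)} {b : Vtx m → Fin ℓ}
    (hb : b ∈ labBlock hℓ idx τ) : Consistent b M := by
  have hb' : ∀ v ∈ everts M, b v = labelAt hℓ idx τ v := (mem_filter.1 hb).2
  have hl : ∀ e (he : e ∈ M), b (Sum.inl e.1) = τ (idx ⟨e, he⟩) := fun e he => by
    rw [hb' _ (inl_mem_everts.2 ⟨e, he, rfl⟩), labelAt_inl hM hℓ idx τ he]
  have hr : ∀ e (he : e ∈ M), b (Sum.inr e.2) = τ (idx ⟨e, he⟩) := fun e he => by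
    rw [hb' _ (inr_mem_everts.2 ⟨e, he, rfl⟩), labelAt_inr hM hℓ idx τ he]
  refine ⟨fun e he => by rw [hl e he, hr e he], fun e₁ h₁ e₂ h₂ h => ?_⟩
  rw [hl e₁ h₁, hl e₂ h₂] at h
  have := idx.injective (τ.injective h)
  exact congrArg Subtype.val this

/-- The number of labellings following a prescription: `ℓ ^ (2m − |everts M|)`. [folklore] -/
private theorem card_labBlock (τ : Equiv.Perm (Fin ℓ)) :
    #(labBlock hℓ idx τ (M := M)) = ℓ ^ (Fintype.card (Vtx m) - #(everts M)) := by
  classical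
  have hset : labBlock hℓ idx τ (M := M) =
      Fintype.piFinset fun v : Vtx m =>
        if v ∈ everts M then ({labelAt hℓ idx τ v} : Finset (Fin ℓ)) else univ := by
    ext b
    simp only [labBlock, mem_filter, mem_univ, true_and, Fintype.mem_piFinset]
    constructor
    · intro h v
      split_ifs with hv
      · rw [mem_singleton]; exact h v hv
      · exact mem_univ _
    · intro h v hv
      have := h v
      rw [if_pos hv, mem_singleton] at this
      exact this
  rw [hset, Fintype.card_piFinset]
  rw [← prod_filter_mul_prod_filter_not univ (fun v => v ∈ everts M)]
  have h1 : ∏ v ∈ univ.filter (fun v : Vtx m => v ∈ everts M),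
      #(if v ∈ everts M then ({labelAt hℓ idx τ v} : Finset (Fin ℓ)) else univ) = 1 := by
    refine prod_eq_one fun v hv => ?_
    rw [if_pos (mem_filter.1 hv).2, card_singleton]
  have h2 : ∏ v ∈ univ.filter (fun v : Vtx m => ¬ v ∈ everts M),
      #(if v ∈ everts M then ({labelAt hℓ idx τ v} : Finset (Fin ℓ)) else univ) =
        ℓ ^ (Fintype.card (Vtx m) - #(everts M)) := by
    rw [prod_congr rfl fun v hv => by rw [if_neg (mem_filter.1 hv).2, card_univ, Fintype.card_fin],
      prod_const]
    congr 1
    have : univ.filter (fun v : Vtx m => ¬ v ∈ everts M) = (everts M)ᶜ := by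
      ext v; simp
    rw [this, card_compl]
  rw [h1, h2, one_mul]

include hM in
/-- Different permutations prescribe disjoint sets of labellings. [folklore] -/
private theorem disjoint_labBlock {τ τ' : Equiv.Perm (Fin ℓ)} (hne : τ ≠ τ') :
    Disjoint (labBlock hℓ idx τ (M := M)) (labBlock hℓ idx τ') := by
  rw [disjoint_left]
  intro b hb hb'
  apply hne
  ext i
  obtain ⟨⟨e, he⟩, hei⟩ := idx.surjective i
  have h1 := (mem_filter.1 hb).2 _ (inl_mem_everts.2 ⟨e, he, rfl⟩)
  have h2 := (mem_filter.1 hb').2 _ (inl_mem_everts.2 ⟨e, he, rfl⟩)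
  rw [labelAt_inl hM hℓ idx _ he, hei] at h1 h2
  rw [← h1, ← h2]

include hM hℓ idx in
/-- **Each `ℓ`-matching is consistent with at least `ℓ! · ℓ^{2m−2ℓ}` labellings** (`ℓ!` choices
of the edge labels, free labels elsewhere). [cite: CavalarEtAl2026, §2 ("there are ℓ^{2ℓ} ways of labelling its endpoints, and ℓ! of these yield a consistent labelling")] -/
theorem card_consistent_ge (hMℓ : #M = ℓ) :
    ℓ.factorial * ℓ ^ (Fintype.card (Vtx m) - 2 * ℓ) ≤
      #(univ.filter fun b : Vtx m → Fin ℓ => Consistent b M) := by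
  classical
  have hsub : (univ : Finset (Equiv.Perm (Fin ℓ))).biUnion (fun τ => labBlock hℓ idx τ (M := M)) ⊆
      univ.filter fun b : Vtx m → Fin ℓ => Consistent b M := by
    intro b hb
    obtain ⟨τ, -, hτ⟩ := mem_biUnion.1 hb
    exact mem_filter.2 ⟨mem_univ _, consistent_of_mem_labBlock hM hℓ idx hτ⟩
  refine le_trans ?_ (card_le_card hsub)
  rw [card_biUnion (fun τ _ τ' _ hne => disjoint_labBlock hM hℓ idx hne)]
  simp only [card_labBlock, sum_const, card_univ, Fintype.card_perm, Fintype.card_fin, smul_eq_mul]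
  rw [hM.card_everts, hMℓ]

end Labels


/-- **A labelling consistent with many matchings** (averaging over all `ℓ^{2m}` labellings):
for a family `𝓕` of `ℓ`-matchings (`ℓ ≥ 1`) some labelling `b` has
`|𝓕| · ℓ! ≤ |{M ∈ 𝓕 : M consistent with b}| · ℓ^{2ℓ}`. [cite: CavalarEtAl2026, §2 ("By averaging, there exists a fixed labelling b …")] -/
theorem exists_labelling (𝓕 : Finset (Finset (Edge m))) (hℓ : 1 ≤ ℓ)
    (h𝓕 : ∀ M ∈ 𝓕, IsMatching M ∧ #M = ℓ) :
    ∃ b : Vtx m → Fin ℓ,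
      #𝓕 * ℓ.factorial ≤ #(𝓕.filter fun M => Consistent b M) * ℓ ^ (2 * ℓ) := by
  classical
  by_cases hne : 𝓕 = ∅
  · exact ⟨fun _ => ⟨0, hℓ⟩, by simp [hne]⟩
  obtain ⟨M₀, hM₀⟩ := nonempty_iff_ne_empty.2 hne
  have hℓm : ℓ ≤ m := by
    have := (h𝓕 M₀ hM₀).1.card_le
    rw [(h𝓕 M₀ hM₀).2] at this
    exact this
  set N : ℕ := Fintype.card (Vtx m) with hNdef
  have hN : N = 2 * m := by
    simp only [hNdef, Fintype.card_sum, Fintype.card_fin]; ring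
  have h2ℓN : 2 * ℓ ≤ N := by rw [hN]; omega
  set K : ℕ := ℓ.factorial * ℓ ^ (N - 2 * ℓ) with hK
  -- double counting of the pairs (labelling, consistent matching)
  have hdc : ∑ b : Vtx m → Fin ℓ, #(𝓕.filter fun M => Consistent b M) =
      ∑ M ∈ 𝓕, #(univ.filter fun b : Vtx m → Fin ℓ => Consistent b M) := by
    simp only [card_filter]
    exact sum_comm
  have hlow : #𝓕 * K ≤ ∑ b : Vtx m → Fin ℓ, #(𝓕.filter fun M => Consistent b M) := by
    rw [hdc]
    have : ∑ M ∈ 𝓕, K ≤ ∑ M ∈ 𝓕, #(univ.filter fun b : Vtx m → Fin ℓ => Consistent b M) := by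
      refine sum_le_sum fun M hM => ?_
      obtain ⟨hMm, hMℓ⟩ := h𝓕 M hM
      have hcard : Fintype.card M = ℓ := by rw [Fintype.card_coe, hMℓ]
      exact card_consistent_ge hMm hℓ (Fintype.equivFinOfCardEq hcard) hMℓ
    rw [sum_const, smul_eq_mul] at this
    exact this
  -- pigeonhole over the `ℓ^N` labellings
  have hcardB : #(univ : Finset (Vtx m → Fin ℓ)) = ℓ ^ N := by
    rw [card_univ, Fintype.card_fun, Fintype.card_fin]
  have hBne : (univ : Finset (Vtx m → Fin ℓ)).Nonempty := ⟨fun _ => ⟨0, hℓ⟩, mem_univ _⟩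
  obtain ⟨b, -, hb⟩ := exists_le_of_sum_le (s := (univ : Finset (Vtx m → Fin ℓ)))
    hBne (f := fun _ => #𝓕 * K)
    (g := fun b => #(𝓕.filter fun M => Consistent b M) * ℓ ^ N) (by
      rw [sum_const, hcardB, smul_eq_mul, ← sum_mul, mul_comm]
      exact Nat.mul_le_mul_right _ hlow)
  refine ⟨b, ?_⟩
  have hpow : ℓ ^ N = ℓ ^ (2 * ℓ) * ℓ ^ (N - 2 * ℓ) := by
    rw [← pow_add, Nat.add_sub_cancel' h2ℓN]
  have hpos : 0 < ℓ ^ (N - 2 * ℓ) := by positivity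
  rw [hK, hpow, ← mul_assoc, ← mul_assoc] at hb
  exact Nat.le_of_mul_le_mul_right hb hpos


/-! ### From a vertex sunflower to a matching sunflower (CGRSS §2, Claim 1) -/

section Claim

variable {b : Vtx m → Fin ℓ} {𝓕' : Finset (Finset (Edge m))}
  (h𝓕' : ∀ M ∈ 𝓕', IsMatching M ∧ Consistent b M)

include h𝓕' in
/-- An edge of a member whose two endpoints lie in the vertex core `K = ⋂ V(M)` lies in the edge
core `D = ⋂ 𝓕'` (blockiness). [cite: CavalarEtAl2026, §2, Claim 1 ("D ⊆ ⋂𝓕'")] -/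
theorem mem_core_of_endpoints {M : Finset (Edge m)} (hM : M ∈ 𝓕') {e : Edge m} (he : e ∈ M)
    (hu : (Sum.inl e.1 : Vtx m) ∈ SetFamily.core (𝓕'.image everts))
    (hv : (Sum.inr e.2 : Vtx m) ∈ SetFamily.core (𝓕'.image everts)) : e ∈ core 𝓕' := by
  rw [mem_core]
  intro M' hM'
  have hKM' : SetFamily.core (𝓕'.image everts) ⊆ everts M' :=
    SetFamily.core_subset (mem_image_of_mem _ hM')
  obtain ⟨e', he', h1⟩ := inl_mem_everts.1 (hKM' hu)
  obtain ⟨e'', he'', h2⟩ := inr_mem_everts.1 (hKM' hv)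
  have hlab : b (Sum.inl e'.1) = b (Sum.inr e''.2) := by
    rw [h1, h2]; exact (h𝓕' M hM).2.1 e he
  have hee : e' = e'' := (h𝓕' M' hM').2.eq_of_label_eq he' he'' hlab
  have : e = e' := by subst hee; exact Prod.ext h1.symm h2.symm
  rw [this]; exact he'

include h𝓕' in
/-- In a blocky family, a core vertex carrying the label of an edge `e ∈ M` is an endpoint of
`e`. [cite: CavalarEtAl2026, §2 (blocks contain 0, 1 or 2 core vertices)] -/
theorem eq_endpoint_of_label {M : Finset (Edge m)} (hM : M ∈ 𝓕') {e : Edge m} (he : e ∈ M)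
    {w : Vtx m} (hw : w ∈ SetFamily.core (𝓕'.image everts)) (hbw : b w = b (Sum.inl e.1)) :
    w = Sum.inl e.1 ∨ w = Sum.inr e.2 := by
  have hwM : w ∈ everts M := SetFamily.core_subset (mem_image_of_mem _ hM) hw
  have hmono := (h𝓕' M hM).2.1 e he
  rcases w with u' | v'
  · obtain ⟨e', he', h1⟩ := inl_mem_everts.1 hwM
    left
    have : e' = e := (h𝓕' M hM).2.eq_of_label_eq he' he (by rw [h1, hbw, hmono])
    rw [← h1, this]
  · obtain ⟨e'', he'', h2⟩ := inr_mem_everts.1 hwM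
    right
    have : e = e'' := (h𝓕' M hM).2.eq_of_label_eq he he'' (by rw [h2]; exact hbw.symm)
    rw [← h2, ← this]

variable (b 𝓕') in
/-- the core vertices that are alone in their label class within the core (`K₁` of CGRSS)
[cite: CavalarEtAl2026, §2 (before Claim 1: `K = K₁ ⊔ K₂`)] -/
def soloCore : Finset (Vtx m) :=
  (SetFamily.core (𝓕'.image everts)).filter fun w =>
    ∀ w' ∈ SetFamily.core (𝓕'.image everts), b w' = b w → w' = w

variable (b 𝓕') in
/-- the recolouring pattern `x^α` of CGRSS: flip the vertices whose label is the label of a solo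
core vertex coloured `0` [cite: CavalarEtAl2026, §2 (proof of Claim 1, `x^α`)] -/
def flipBit (x : Vtx m → Bool) (v : Vtx m) : Bool :=
  decide (∃ w ∈ soloCore b 𝓕', b w = b v ∧ x w = false)

variable (b 𝓕') in
/-- the involution `x ↦ x ⊕ x^{α(x)}` off the solo core vertices (CGRSS: "flip the colours in all
blocks that contain `v ∈ K₁` with `α_v = 0`") [cite: CavalarEtAl2026, §2 (proof of Claim 1)] -/
def theta (x : Vtx m → Bool) : Vtx m → Bool := fun v =>
  if v ∈ soloCore b 𝓕' then x v else xor (x v) (flipBit b 𝓕' x v)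

/-- `theta` fixes the solo core vertices. [folklore] -/
private theorem theta_of_mem {x : Vtx m → Bool} {v : Vtx m} (hv : v ∈ soloCore b 𝓕') :
    theta b 𝓕' x v = x v := by
  simp [theta, hv]

/-- `theta` off the solo core. [folklore] -/
private theorem theta_of_not_mem {x : Vtx m → Bool} {v : Vtx m} (hv : v ∉ soloCore b 𝓕') :
    theta b 𝓕' x v = xor (x v) (flipBit b 𝓕' x v) := by
  simp [theta, hv]

/-- The flip pattern only depends on the colours of the solo core vertices, which `theta` keeps.
[folklore] -/
private theorem flipBit_theta (x : Vtx m → Bool) (v : Vtx m) :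
    flipBit b 𝓕' (theta b 𝓕' x) v = flipBit b 𝓕' x v := by
  unfold flipBit
  congr 1
  refine propext (exists_congr fun w => ?_)
  constructor
  · rintro ⟨hw, hb, hx⟩; exact ⟨hw, hb, by rwa [theta_of_mem hw] at hx⟩
  · rintro ⟨hw, hb, hx⟩; exact ⟨hw, hb, by rwa [theta_of_mem hw]⟩

/-- `theta` is an involution. [folklore] -/
private theorem theta_theta (x : Vtx m → Bool) : theta b 𝓕' (theta b 𝓕' x) = x := by
  funext v
  by_cases hv : v ∈ soloCore b 𝓕'
  · rw [theta_of_mem hv, theta_of_mem hv]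
  · rw [theta_of_not_mem hv, flipBit_theta, theta_of_not_mem hv, Bool.xor_assoc, Bool.xor_self,
      Bool.xor_false]

/-- The flip pattern is a function of the label. [folklore] -/
private theorem flipBit_eq_of_label_eq (x : Vtx m → Bool) {v v' : Vtx m} (h : b v = b v') :
    flipBit b 𝓕' x v = flipBit b 𝓕' x v' := by
  unfold flipBit; rw [h]

/-- Next to a solo core vertex `v'` the flip pattern is `¬ x v'`. [folklore] -/
private theorem flipBit_eq_not {x : Vtx m → Bool} {v v' : Vtx m} (hv' : v' ∈ soloCore b 𝓕')
    (h : b v = b v') : flipBit b 𝓕' x v = !(x v') := by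
  unfold flipBit
  have huniq : ∀ w ∈ soloCore b 𝓕', b w = b v → w = v' := by
    intro w hw hbw
    have hv'1 := (mem_filter.1 hv').2
    exact hv'1 w (mem_filter.1 hw).1 (hbw.trans h)
  cases hx : x v'
  · simp only [Bool.not_false, decide_eq_true_eq]
    exact ⟨v', hv', h.symm, hx⟩
  · simp only [Bool.not_true, decide_eq_false_iff_not, not_exists, not_and]
    intro w hw hbw hxw
    rw [huniq w hw hbw, hx] at hxw
    exact Bool.noConfusion hxw

include h𝓕' in
/-- **CGRSS Claim 1, pointwise**: if, after the recolouring `theta`, every non-core endpoint of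
some member `M` is coloured `1`, then every edge of `M` outside the edge core is monochromatic.
[cite: CavalarEtAl2026, §2, Claim 1 (the three cases `uv ∩ K = ∅`, `= {v}`, `⊆ K`)] -/
theorem good_of_hit {x : Vtx m → Bool} {M : Finset (Edge m)} (hM : M ∈ 𝓕')
    (hhit : ∀ v ∈ everts M, v ∉ SetFamily.core (𝓕'.image everts) → theta b 𝓕' x v = true) :
    M \ core 𝓕' ⊆ colorGraph x := by
  set K := SetFamily.core (𝓕'.image everts) with hK
  rw [subset_colorGraph_iff]
  intro e he
  obtain ⟨heM, heD⟩ := mem_sdiff.1 he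
  have hmono : b (Sum.inl e.1) = b (Sum.inr e.2) := (h𝓕' M hM).2.1 e heM
  have huM : (Sum.inl e.1 : Vtx m) ∈ everts M := inl_mem_everts.2 ⟨e, heM, rfl⟩
  have hvM : (Sum.inr e.2 : Vtx m) ∈ everts M := inr_mem_everts.2 ⟨e, heM, rfl⟩
  -- a core endpoint of `e ∉ D` is solo, and the other endpoint is not in the core
  have hsolo : ∀ {w w₂ : Vtx m}, (w = Sum.inl e.1 ∧ w₂ = Sum.inr e.2) ∨ (w = Sum.inr e.2 ∧ w₂ = Sum.inl e.1) →
      w ∈ K → w₂ ∉ K → w ∈ soloCore b 𝓕' := by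
    rintro w w₂ hww hw hw₂
    refine mem_filter.2 ⟨hw, fun w' hw' hbw' => ?_⟩
    have hbw'e : b w' = b (Sum.inl e.1) := by
      rcases hww with ⟨rfl, rfl⟩ | ⟨rfl, rfl⟩
      · exact hbw'
      · rw [hbw', hmono]
    rcases eq_endpoint_of_label h𝓕' hM heM hw' hbw'e with h | h
    · rcases hww with ⟨rfl, rfl⟩ | ⟨rfl, rfl⟩
      · exact h
      · exact absurd (h ▸ hw') hw₂
    · rcases hww with ⟨rfl, rfl⟩ | ⟨rfl, rfl⟩
      · exact absurd (h ▸ hw') hw₂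
      · exact h
  by_cases hu : (Sum.inl e.1 : Vtx m) ∈ K <;> by_cases hv : (Sum.inr e.2 : Vtx m) ∈ K
  · exact absurd (mem_core_of_endpoints h𝓕' hM heM hu hv) heD
  · -- `u ∈ K` solo, `v ∉ K`
    have hus : (Sum.inl e.1 : Vtx m) ∈ soloCore b 𝓕' := hsolo (Or.inl ⟨rfl, rfl⟩) hu hv
    have hvs : (Sum.inr e.2 : Vtx m) ∉ soloCore b 𝓕' := fun h => hv (mem_filter.1 h).1
    have h1 := hhit _ hvM hv
    rw [theta_of_not_mem hvs, flipBit_eq_not hus hmono.symm] at h1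
    revert h1
    cases x (Sum.inl e.1) <;> cases x (Sum.inr e.2) <;> simp
  · -- `v ∈ K` solo, `u ∉ K`
    have hvs : (Sum.inr e.2 : Vtx m) ∈ soloCore b 𝓕' := hsolo (Or.inr ⟨rfl, rfl⟩) hv hu
    have hus : (Sum.inl e.1 : Vtx m) ∉ soloCore b 𝓕' := fun h => hu (mem_filter.1 h).1
    have h1 := hhit _ huM hu
    rw [theta_of_not_mem hus, flipBit_eq_not hvs hmono] at h1
    revert h1
    cases x (Sum.inl e.1) <;> cases x (Sum.inr e.2) <;> simp
  · -- both endpoints outside the core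
    have hus : (Sum.inl e.1 : Vtx m) ∉ soloCore b 𝓕' := fun h => hu (mem_filter.1 h).1
    have hvs : (Sum.inr e.2 : Vtx m) ∉ soloCore b 𝓕' := fun h => hv (mem_filter.1 h).1
    have h1 := hhit _ huM hu
    have h2 := hhit _ hvM hv
    rw [theta_of_not_mem hus] at h1
    rw [theta_of_not_mem hvs, ← flipBit_eq_of_label_eq x hmono] at h2
    revert h1 h2
    cases x (Sum.inl e.1) <;> cases x (Sum.inr e.2) <;> cases flipBit b 𝓕' x (Sum.inl e.1) <;> simp

include h𝓕' in
/-- **The counting form of Claim 1**: at least as many colourings make some member monochromatic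
outside the edge core as make some member's non-core endpoints all `1` (the involution `theta`
maps the second event into the first). [cite: CavalarEtAl2026, §2, Claim 1 (eq. (error))] -/
theorem card_hit_le_card_good :
    #(univ.filter fun y : Vtx m → Bool =>
        ∃ M ∈ 𝓕', ∀ v ∈ everts M, v ∉ SetFamily.core (𝓕'.image everts) → y v = true) ≤
      #(univ.filter fun x : Vtx m → Bool => ∃ M ∈ 𝓕', M \ core 𝓕' ⊆ colorGraph x) := by
  classical
  set S := univ.filter fun y : Vtx m → Bool =>
    ∃ M ∈ 𝓕', ∀ v ∈ everts M, v ∉ SetFamily.core (𝓕'.image everts) → y v = true with hS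
  have hinj : Function.Injective (theta b 𝓕') :=
    Function.LeftInverse.injective (g := theta b 𝓕') fun x => theta_theta x
  calc #S = #(S.image (theta b 𝓕')) := (card_image_of_injective _ hinj).symm
    _ ≤ _ := card_le_card fun x hx => by
        obtain ⟨y, hy, rfl⟩ := mem_image.1 hx
        obtain ⟨M, hM, hMy⟩ := (mem_filter.1 hy).2
        refine mem_filter.2 ⟨mem_univ _, M, hM, good_of_hit h𝓕' hM fun v hv hvK => ?_⟩
        rw [theta_theta]
        exact hMy v hv hvK

end Claim


/-! ### Assembly: the Matching Sunflower Lemma -/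

/-- `μ_{1/2}` is uniform: each subset of a finite set has weight `2^{-|α|}`. [folklore] -/
private theorem biasedWeight_half' {α : Type*} [Fintype α] (W : Finset α) :
    SetFamily.biasedWeight (1 / 2) W = 1 / 2 ^ Fintype.card α := by
  unfold SetFamily.biasedWeight
  rw [show (1 : ℝ) - 1 / 2 = 1 / 2 by norm_num, ← pow_add, Nat.add_sub_cancel' (card_le_univ W),
    one_div_pow]

/-- `ℓ^ℓ ≤ 3^ℓ · ℓ!` (from `ℓ^ℓ / ℓ! ≤ e^ℓ`). [folklore] -/
private theorem pow_self_le_three_pow_mul_factorial (ℓ : ℕ) :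
    ((ℓ : ℝ)) ^ ℓ ≤ (3 : ℝ) ^ ℓ * ℓ.factorial := by
  have h1 := Real.pow_div_factorial_le_exp (ℓ : ℝ) (show (0 : ℝ) ≤ (ℓ : ℝ) by positivity) ℓ
  have hfac : (0 : ℝ) < ℓ.factorial := by exact_mod_cast Nat.factorial_pos ℓ
  rw [div_le_iff₀ hfac] at h1
  have h2 : Real.exp ℓ ≤ (3 : ℝ) ^ ℓ := by
    rw [show (ℓ : ℝ) = ℓ * 1 by ring, Real.exp_nat_mul]
    exact pow_le_pow_left₀ (Real.exp_pos 1).le (by have := Real.exp_one_lt_d9; linarith) ℓ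
  calc ((ℓ : ℝ)) ^ ℓ ≤ Real.exp ℓ * ℓ.factorial := h1
    _ ≤ (3 : ℝ) ^ ℓ * ℓ.factorial := mul_le_mul_of_nonneg_right h2 hfac.le

end PerfectMatching

open Finset PerfectMatching Literature.Combinatorics

/-- **CGRSS Lemma 2 (Matching Sunflower Lemma), proved**: with `c = 108 · B²`, `B = 2000` the
spread-lemma constant, every family of `ℓ`-matchings of `K_{m,m}` (`ℓ ≥ 1`, `0 < ε ≤ 1/2`) with
`|𝓕| ≥ (c ℓ log²(ℓ/ε))^ℓ` contains an `ε`-matching sunflower. Proof as printed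
([cite: CavalarEtAl2026, §2]): a labelling `b` consistent with `≥ |𝓕| ℓ!/ℓ^{2ℓ}` members
(`exists_labelling`); the consistent members are determined by their `2ℓ`-sets of endpoints
(`Consistent.eq_of_everts_eq`), to which the robust sunflower theorem
(`Literature.Combinatorics.SetFamily.robust_sunflower_spreadConst`, `p = 1/2`, `ε/2`) applies;
Claim 1 (`card_hit_le_card_good`, via the involution `theta`) turns the `ε/2`-robust vertex
sunflower into the matching-sunflower event for a uniform colouring, and conditioning on odd
parity at most doubles the error. Discharges the named fact `CavalarEtAl2026_matchingSunflower`.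
[cite: CavalarEtAl2026, Lemma 2 (§1.1; proof §2, Claim 1)] -/
theorem CavalarEtAl2026_matchingSunflower_holds : CavalarEtAl2026_matchingSunflower := by
  classical
  refine ⟨108 * SetFamily.spreadConst ^ 2, by have := SetFamily.spreadConst_pos; positivity, ?_⟩
  intro m ℓ ε hℓ hε0 hε1 𝓕 h𝓕 hbig
  set B : ℝ := SetFamily.spreadConst with hB
  have hBpos : 0 < B := SetFamily.spreadConst_pos
  set L : ℝ := Real.log (ℓ / ε) with hL
  -- positivity of the threshold, nonemptiness, `m ≥ 1`
  have hℓr : (1 : ℝ) ≤ ℓ := by exact_mod_cast hℓ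
  have hx2 : (2 : ℝ) ≤ ℓ / ε := by rw [le_div_iff₀ hε0]; linarith
  have hL2 : Real.log 2 ≤ L := Real.log_le_log two_pos hx2
  have hLpos : 0 < L := lt_of_lt_of_le (Real.log_pos one_lt_two) hL2
  have hthr : 0 < (108 * B ^ 2 * ℓ * L ^ 2) ^ ℓ := by positivity
  have h𝓕ne : 𝓕.Nonempty := by
    rw [← card_pos]
    have : (0 : ℝ) < #𝓕 := hthr.trans_le hbig
    exact_mod_cast this
  obtain ⟨M₀, hM₀⟩ := h𝓕ne
  have hm : 1 ≤ m := by
    obtain ⟨e, _⟩ : M₀.Nonempty := by rw [← card_pos, (h𝓕 M₀ hM₀).2]; exact hℓ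
    exact e.1.pos
  -- Step 1: a good labelling and the blocky family
  obtain ⟨b, hb⟩ := exists_labelling 𝓕 hℓ h𝓕
  set 𝓕b := 𝓕.filter fun M => Consistent b M with h𝓕b
  have h𝓕b : ∀ M ∈ 𝓕b, IsMatching M ∧ Consistent b M := fun M hM =>
    ⟨(h𝓕 M (mem_filter.1 hM).1).1, (mem_filter.1 hM).2⟩
  -- Step 2: the vertex family
  set 𝒱 := 𝓕b.image everts with h𝒱
  have hinj : Set.InjOn everts (𝓕b : Set (Finset (Edge m))) := fun M hM M' hM' h =>
    (h𝓕b M hM).2.eq_of_everts_eq (h𝓕b M' hM').2 h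
  have h𝒱card : #𝒱 = #𝓕b := card_image_of_injOn hinj
  have h𝒱unif : ∀ V ∈ 𝒱, #V = 2 * ℓ := by
    intro V hV
    obtain ⟨M, hM, rfl⟩ := mem_image.1 hV
    rw [(h𝓕b M hM).1.card_everts, (h𝓕 M (mem_filter.1 hM).1).2]
  -- Step 3: the size of `𝒱` beats the robust-sunflower threshold
  have hsize : (B * Real.log (((2 * ℓ : ℕ) : ℝ) / (ε / 2)) / (1 / 2)) ^ (2 * ℓ) ≤ (#𝒱 : ℝ) := by
    have hlog : Real.log (((2 * ℓ : ℕ) : ℝ) / (ε / 2)) = Real.log 4 + L := by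
      have : ((2 * ℓ : ℕ) : ℝ) / (ε / 2) = 4 * (ℓ / ε) := by push_cast; field_simp; ring
      rw [this, Real.log_mul (by norm_num) (by positivity)]
    have hlog4 : Real.log 4 = 2 * Real.log 2 := by
      rw [show (4 : ℝ) = 2 ^ 2 by norm_num, Real.log_pow]; norm_num
    have hlogle : Real.log (((2 * ℓ : ℕ) : ℝ) / (ε / 2)) ≤ 3 * L := by rw [hlog, hlog4]; linarith
    have hlog0 : 0 ≤ Real.log (((2 * ℓ : ℕ) : ℝ) / (ε / 2)) := by rw [hlog, hlog4]; positivity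
    -- threshold ≤ (6BL)^{2ℓ} = (36 B² L²)^ℓ
    have hT : (B * Real.log (((2 * ℓ : ℕ) : ℝ) / (ε / 2)) / (1 / 2)) ^ (2 * ℓ) ≤
        (36 * B ^ 2 * L ^ 2) ^ ℓ := by
      have h6 : B * Real.log (((2 * ℓ : ℕ) : ℝ) / (ε / 2)) / (1 / 2) ≤ 6 * B * L := by
        rw [div_le_iff₀ (by norm_num : (0 : ℝ) < 1 / 2)]
        nlinarith
      calc (B * Real.log (((2 * ℓ : ℕ) : ℝ) / (ε / 2)) / (1 / 2)) ^ (2 * ℓ)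
          ≤ (6 * B * L) ^ (2 * ℓ) := pow_le_pow_left₀ (by positivity) h6 _
        _ = (36 * B ^ 2 * L ^ 2) ^ ℓ := by rw [pow_mul]; ring
    -- the blocky family is large: #𝓕b ℓ^{2ℓ} ≥ #𝓕 ℓ! ≥ (c ℓ L²)^ℓ ℓ!
    have hbR : (#𝓕 : ℝ) * ℓ.factorial ≤ #𝓕b * (ℓ : ℝ) ^ (2 * ℓ) := by exact_mod_cast hb
    have hfac := pow_self_le_three_pow_mul_factorial ℓ
    have hℓpow : (0 : ℝ) < (ℓ : ℝ) ^ (2 * ℓ) := by positivity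
    rw [h𝒱card]
    refine le_of_mul_le_mul_right ?_ hℓpow
    calc (B * Real.log (((2 * ℓ : ℕ) : ℝ) / (ε / 2)) / (1 / 2)) ^ (2 * ℓ) * (ℓ : ℝ) ^ (2 * ℓ)
        ≤ (36 * B ^ 2 * L ^ 2) ^ ℓ * (ℓ : ℝ) ^ (2 * ℓ) := mul_le_mul_of_nonneg_right hT hℓpow.le
      _ = (36 * B ^ 2 * L ^ 2 * ℓ) ^ ℓ * (ℓ : ℝ) ^ ℓ := by rw [pow_mul, ← mul_pow, ← mul_pow]; ring
      _ ≤ (36 * B ^ 2 * L ^ 2 * ℓ) ^ ℓ * ((3 : ℝ) ^ ℓ * ℓ.factorial) :=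
          mul_le_mul_of_nonneg_left hfac (by positivity)
      _ = (108 * B ^ 2 * ℓ * L ^ 2) ^ ℓ * ℓ.factorial := by rw [← mul_assoc, ← mul_pow]; ring
      _ ≤ #𝓕 * ℓ.factorial := mul_le_mul_of_nonneg_right hbig (by positivity)
      _ ≤ #𝓕b * (ℓ : ℝ) ^ (2 * ℓ) := hbR
  -- Step 4: the vertex sunflower and the corresponding matchings
  obtain ⟨𝒱', h𝒱'sub, h𝒱'two, hrob⟩ := SetFamily.robust_sunflower_spreadConst 𝒱 (2 * ℓ) (1 / 2)
    (ε / 2) (by omega) (by norm_num) le_rfl (by positivity) (by linarith) h𝒱unif hsize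
  set 𝓕' := 𝓕b.filter fun M => everts M ∈ 𝒱' with h𝓕'
  have h𝓕'b : ∀ M ∈ 𝓕', IsMatching M ∧ Consistent b M := fun M hM => h𝓕b M (mem_filter.1 hM).1
  have himg : 𝓕'.image everts = 𝒱' := by
    ext V
    constructor
    · intro hV
      obtain ⟨M, hM, rfl⟩ := mem_image.1 hV
      exact (mem_filter.1 hM).2
    · intro hV
      obtain ⟨M, hM, rfl⟩ := mem_image.1 (h𝒱'sub hV)
      exact mem_image.2 ⟨M, mem_filter.2 ⟨hM, hV⟩, rfl⟩
  have h𝓕'card : #𝓕' = #𝒱' := by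
    rw [← himg, card_image_of_injOn fun M hM M' hM' h => hinj (mem_filter.1 hM).1 (mem_filter.1 hM').1 h]
  refine ⟨𝓕', fun M hM => (mem_filter.1 (mem_filter.1 hM).1).1, ?_, ?_⟩
  · rw [h𝓕'card]; exact h𝒱'two
  -- Step 5: the counting
  set N := Fintype.card (Vtx m) with hN
  have hN4 : (2 : ℝ) ^ N = 4 ^ m := by
    rw [hN, Fintype.card_sum, Fintype.card_fin, ← two_mul, pow_mul]; norm_num
  set K := SetFamily.core (𝓕'.image everts) with hK
  -- (a) robustness, as a count of subsets `W`
  have hrobW : (1 - ε / 2) * (2 : ℝ) ^ N <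
      #(univ.filter fun W : Finset (Vtx m) => ∃ V ∈ 𝒱', V ⊆ W ∪ SetFamily.core 𝒱') := by
    unfold SetFamily.IsRobustSunflower at hrob
    simp only [biasedWeight_half', sum_const, nsmul_eq_mul] at hrob
    have h2N : (0 : ℝ) < 2 ^ N := by positivity
    rw [← hN] at hrob
    have := mul_lt_mul_of_pos_right hrob h2N
    rwa [mul_assoc, one_div_mul_cancel h2N.ne', mul_one] at this
  -- (b) subsets `W` ↔ colourings `y`
  have hWy : #(univ.filter fun W : Finset (Vtx m) => ∃ V ∈ 𝒱', V ⊆ W ∪ SetFamily.core 𝒱') =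
      #(univ.filter fun y : Vtx m → Bool =>
        ∃ M ∈ 𝓕', ∀ v ∈ everts M, v ∉ K → y v = true) := by
    rw [← himg]
    refine card_bij' (fun W _ => fun v => decide (v ∈ W)) (fun y _ => univ.filter fun v => y v = true)
      ?_ ?_ ?_ ?_
    · intro W hW
      obtain ⟨V, hV, hVW⟩ := (mem_filter.1 hW).2
      obtain ⟨M, hM, rfl⟩ := mem_image.1 hV
      refine mem_filter.2 ⟨mem_univ _, M, hM, fun v hv hvK => ?_⟩
      have := hVW hv
      rw [mem_union] at this
      rcases this with h | h
      · simpa using h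
      · exact absurd h hvK
    · intro y hy
      obtain ⟨M, hM, hMy⟩ := (mem_filter.1 hy).2
      refine mem_filter.2 ⟨mem_univ _, everts M, mem_image_of_mem _ hM, fun v hv => ?_⟩
      rw [mem_union]
      by_cases hvK : v ∈ K
      · exact Or.inr hvK
      · exact Or.inl (mem_filter.2 ⟨mem_univ _, hMy v hv hvK⟩)
    · intro W _; ext v; simp
    · intro y _; funext v; simp
  -- (c) Claim 1
  have hgood := card_hit_le_card_good h𝓕'b (b := b)
  -- (d) parity
  set A := oddColorings m with hA
  set G := univ.filter fun x : Vtx m → Bool => ∃ M ∈ 𝓕', M \ core 𝓕' ⊆ colorGraph x with hG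
  have hAcard : 2 * (#A : ℝ) = 2 ^ N := by
    rw [hN4]; exact_mod_cast two_mul_card_oddColorings hm
  have hGcard : (1 - ε / 2) * (2 : ℝ) ^ N < #G := by
    calc (1 - ε / 2) * (2 : ℝ) ^ N < _ := hrobW
      _ ≤ #G := by rw [hWy]; exact_mod_cast hgood
  have hAG : A.filter (fun x => ∃ M ∈ 𝓕', M \ core 𝓕' ⊆ colorGraph x) = A ∩ G := by
    ext x; simp [hG]
  have hunion : (#(A ∪ G) : ℝ) ≤ 2 ^ N := by
    have h1 : #(A ∪ G) ≤ Fintype.card (Vtx m → Bool) := card_le_univ _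
    rw [card_colorings] at h1
    rw [hN4]; exact_mod_cast h1
  have hie : (#(A ∪ G) : ℝ) + #(A ∩ G) = #A + #G := by exact_mod_cast card_union_add_card_inter A G
  have hprod : ε * (#A : ℝ) = ε / 2 * 2 ^ N := by rw [← hAcard]; ring
  rw [hAG]
  nlinarith [hie, hunion, hGcard, hprod, hAcard]

end Literature.Computability.Complexity
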